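import Mathlib.Analysis.InnerProductSpace.LaxMilgram
import Mathlib.Analysis.InnerProductSpace.Completion
import Mathlib.Analysis.Normed.Operator.Extend
import Mathlib.Analysis.Normed.Module.Completion
import Mathlib.Geometry.Manifold.Algebra.SmoothFunctions
import Literature.Geometry.Lorentzian.WeakSolutionRegularity
import Literature.Geometry.Lorentzian.GreenIdentity
import Literature.Geometry.Riemannian.YamabePositivity
import Literature.Geometry.Riemannian.RicciFlowScalarMaximumPrinciple
import Literature.Geometry.Lorentzian.DalembertianCompose
import Literature.Analysis.Distribution.EllipticRegularityProofs
import HarnessLib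

/-!
# Smooth positive solutions of `Δ_h v − f v = g` for a coercive Schrödinger form on a closed
# Riemannian manifold

On a compact Riemannian manifold `(N, h)` without boundary (modelled on `ℝ^m`, `m ≥ 1`), let
`f, g ∈ C^∞(N)` and suppose the Schrödinger form `Q(φ) = ∫ (|dφ|²_h + f φ²) dμ_h` of the operator
`−Δ_h + f` is **coercive on smooth functions**: `c ∫ φ² dμ_h ≤ Q(φ)` for all `φ ∈ C^∞(N)` and some
`c > 0` (positivity of the bottom of the spectrum). We PROVE:

* `exists_weakSolution_of_coercive` — there is `u ∈ L²(N, μ_h)` with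
  `∫ u (Δ_h ζ − f ζ) dμ_h = ∫ g ζ dμ_h` for every `ζ ∈ C^∞(N)` (Lax–Milgram on the completion of
  `C^∞(N)` for the inner product `∫ (h⁻¹(dφ, dψ) + φ ψ) dμ_h`; the abstract step is
  `exists_cauchySeq_tendsto_of_coercive` of `AFLinearWeakExistence.lean`, Gilbarg–Trudinger Thm. 5.8,
  and Green's identity `∫ φ Δ_h ζ = −∫ h⁻¹(dφ, dζ)` on the closed manifold, `GreenIdentity.lean`);
* `exists_smooth_solution_of_coercive` — **there is `v ∈ C^∞(N)` with `Δ_h v − f v = g`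
  everywhere**: interior regularity (Folland 1995, Cor. (6.34), the tree's theorem
  `Folland1995_cor634_holds`) read in charts exactly as in `WeakSolutionRegularity.lean`, here with
  SMOOTH test functions (`integral_comp_extChartAt_symm_divForm_of_veryWeak_smooth`,
  `exists_contMDiffOn_ae_eq_of_veryWeak_smooth`: the proofs of the `C²`-test versions of
  `WeakSolutionChart.lean` / `WeakSolutionRegularity.lean` only ever test against smooth functions),
  patching (`exists_contMDiff_ae_eq_of_forall_exists_nhds`) and
  `dalembertian_sub_mul_eq_of_veryWeak`;
* `pos_of_dalembertian_sub_mul_eq_of_coercive` — **positivity**: if moreover `g < 0` everywhere,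
  every smooth solution `v` of `Δ_h v − f v = g` is everywhere positive. Proof: testing the equation
  against the smooth positive functions `φ_δ = (√(v² + δ²) − v)/2 ↓ v⁻` and using coercivity AT
  `φ_δ` gives `c ∫ (v⁻)² ≤ c ∫ φ_δ² ≤ (δ²/4) ∫ f`, so `v ≥ 0`; at a zero of `v` (a minimum)
  `Δ_h v ≥ 0` (`laplaceBeltrami_nonpos_of_isMaxOn`, `RicciFlowScalarMaximumPrinciple.lean`), which
  contradicts `Δ_h v = g < 0` there;
* `exists_smooth_pos_solution_of_coercive` — the combination: for `g < 0` smooth there is a smooth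
  `v > 0` with `Δ_h v − f v = g`.

This is the linear existence theorem behind Gursky–LeBrun's observation (Gursky–LeBrun 1998,
Prop. 3; Chen–Zhu 2014, Cor. 2.2) that a conformal class whose modified conformal Laplacian has
positive bottom of the spectrum contains a metric of positive modified scalar curvature: with
`f = σ/6`, `g = −1/6` the metric `v² g` has `σ_{v²g} = v⁻³(−6Δv + σ v) = v⁻³ > 0`. It is consumed
in this form by the discharge of `Literature.Geometry.Riemannian.chenZhu2014_conformal_pic_four`.
Everything is proved; no definition and no statement of `Prop` type is introduced (the pre-Hilbert
structure on `C^∞(N)` is local to the proof, as in `AFLinearWeakExistence.lean`).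

## References

* D. Gilbarg, N. S. Trudinger, *Elliptic Partial Differential Equations of Second Order*, Springer
  2001, Thm. 5.8 (Lax–Milgram), Thm. 8.3, Cor. 8.11 (interior regularity). [GilbargTrudinger2001]
* G. B. Folland, *Introduction to Partial Differential Equations*, 2nd ed. (1995), Cor. (6.34).
  [Folland2020]
* M. J. Gursky, C. LeBrun, *Yamabe invariants and Spinᶜ structures*, GAFA 8 (1998) 965–977,
  Prop. 3 and its proof (first eigenfunction of the modified conformal Laplacian). [GurskyLebrun1998]
* B.-L. Chen, X.-P. Zhu, Comm. Anal. Geom. 22 (2014) 811–831, arXiv:1206.5051, Cor. 2.2.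
  [ChenZhu2014]
-/

noncomputable section

open Bundle Set Function Filter Manifold MeasureTheory Measure TopologicalSpace Finset
open scoped Manifold ContDiff Topology Matrix ENNReal

namespace Literature.Geometry.Lorentzian

open PseudoRiemannianMetric

/-! ### The distributional equation with smooth test functions, read in a chart -/

section ChartIdentity

variable {m : ℕ} {H : Type*} [TopologicalSpace H]
  {I : ModelWithCorners ℝ (EuclideanSpace ℝ (Fin m)) H} [I.Boundaryless]
  {N : Type*} [TopologicalSpace N] [ChartedSpace H N] [IsManifold I ∞ N]
  [T2Space N] [LocallyCompactSpace N] [MeasurableSpace N] [BorelSpace N]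
  (h : ContMDiffRiemannianMetric I ∞ (EuclideanSpace ℝ (Fin m)) (TangentSpace I : N → Type _))
  [(ofRiemannian h).HasLeviCivita]

/-- **The distributional equation `Δ_h u − f u = g`, tested against SMOOTH functions, read in a
chart.** Same statement and proof as `integral_comp_extChartAt_symm_divForm_of_veryWeak`
(`WeakSolutionChart.lean`; Chavel 2006, §III.3 (III.3.6), §III.7), with the weak identity assumed
only for `ζ ∈ C^∞_c(N)`: that proof tests the identity against the zero extension of `ψ ∘ φ` for a
smooth `ψ` compactly supported in the chart target, which is smooth.
[cite: Chavel2006, §III.3 (III.3.6)] -/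
theorem integral_comp_extChartAt_symm_divForm_of_veryWeak_smooth (x : N) {u : N → ℝ}
    (hum : Measurable u) {f g : N → ℝ} (hf : Continuous f) (hg : Continuous g)
    (hweak : ∀ ζ : N → ℝ, CMDiff ∞ ζ → HasCompactSupport ζ →
      ∫ p, u p * ((ofRiemannian h).dalembertian ζ p - f p * ζ p) ∂riemannianMeasure h =
        ∫ p, g p * ζ p ∂riemannianMeasure h)
    {ψ : EuclideanSpace ℝ (Fin m) → ℝ} (hψ : ContDiff ℝ ∞ ψ) (hψc : HasCompactSupport ψ)
    (hψT : tsupport ψ ⊆ (extChartAt I x).target) :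
    ∫ y, u ((extChartAt I x).symm y) *
        ((∑ i, ∑ j, fderiv ℝ (fun z ↦ (Real.sqrt (chartGramMatrix h x z).det *
            (chartGramMatrix h x z)⁻¹ j i) *
            fderiv ℝ ψ z ((EuclideanSpace.basisFun (Fin m) ℝ).toBasis i)) y
            ((EuclideanSpace.basisFun (Fin m) ℝ).toBasis j)) -
          (Real.sqrt (chartGramMatrix h x y).det * f ((extChartAt I x).symm y)) * ψ y) =
      ∫ y, (Real.sqrt (chartGramMatrix h x y).det * g ((extChartAt I x).symm y)) * ψ y := by
  classical
  -- notation: the standard basis, the chart target, the Gram matrix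
  set b : Module.Basis (Fin m) ℝ (EuclideanSpace ℝ (Fin m)) := (EuclideanSpace.basisFun (Fin m) ℝ).toBasis
    with hb_def
  obtain ⟨T, hTdef⟩ : ∃ T : Set (EuclideanSpace ℝ (Fin m)), T = (extChartAt I x).target := ⟨_, rfl⟩
  have hT : IsOpen T := by rw [hTdef]; exact isOpen_extChartAt_target x
  have hTm : MeasurableSet T := hT.measurableSet
  have hsrc : (chartAt H x).source = (extChartAt I x).source :=
    (extChartAt_source (I := I) (x := x)).symm
  have hψT' : tsupport ψ ⊆ T := hTdef ▸ hψT
  obtain ⟨Gh, hGh⟩ : ∃ Gh : EuclideanSpace ℝ (Fin m) → Fin m → Fin m → ℝ,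
      Gh = fun y i j ↦ chartGramMatrix h x y i j := ⟨_, rfl⟩
  have hofG : ∀ y, Matrix.of (Gh y) = chartGramMatrix h x y := fun y ↦ by
    rw [hGh]; rfl
  -- the zero extension `ζ` of `ψ ∘ φ`
  obtain ⟨ζ, hζdef⟩ : ∃ ζ : N → ℝ, ζ = (chartAt H x).source.indicator (ψ ∘ extChartAt I x) :=
    ⟨_, rfl⟩
  have hψ2 : ContDiff ℝ 2 ψ := by exact_mod_cast contDiff_infty.1 hψ 2
  have hζs' : CMDiff ∞ ζ := by
    rw [hζdef]
    exact contMDiff_indicator_comp_extChartAt x hψ hψc hψT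
  have hζs : CMDiff 2 ζ := hζs'.of_le (WithTop.coe_le_coe.mpr le_top)
  have hζc : HasCompactSupport ζ := by
    rw [hζdef]; exact hasCompactSupport_indicator_comp_extChartAt x hψc hψT
  obtain ⟨hts, -, hKS⟩ := tsupport_indicator_comp_extChartAt_subset (I := I) x hψc hψT
  have hζsupp : tsupport ζ ⊆ (extChartAt I x).source := by
    rw [hζdef, ← hsrc]; exact hts.trans hKS
  have hζT : ∀ y ∈ T, ζ ((extChartAt I x).symm y) = ψ y := fun y hy ↦ by
    rw [hζdef]; exact indicator_comp_extChartAt_symm_apply x ψ (hTdef ▸ hy)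
  -- the weak identity for `ζ`
  have hW := hweak ζ hζs' hζc
  -- regularity of the metric data on `T`
  have hGT : ∀ y ∈ T, ∀ i j, Gh y i j = (ofRiemannian h).val ((extChartAt I x).symm y)
      ((trivializationAt (EuclideanSpace ℝ (Fin m)) (TangentSpace I) x).localFrame b i
        ((extChartAt I x).symm y))
      ((trivializationAt (EuclideanSpace ℝ (Fin m)) (TangentSpace I) x).localFrame b j
        ((extChartAt I x).symm y)) := by
    intro y hy i j
    rw [hGh]
    exact chartGramMatrix_apply_eq_val_localFrame h x (hTdef ▸ hy) i j
  have hGsm : ∀ i j, ContDiffOn ℝ ∞ (fun y ↦ Gh y i j) T := fun i j ↦ by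
    rw [hTdef]
    exact (contDiffOn_gram_comp_extChartAt_symm b (ofRiemannian h) i j).congr
      (fun y hy ↦ hGT y (hTdef ▸ hy) i j)
  have hGpi : ContDiffOn ℝ ∞ Gh T :=
    contDiffOn_pi.2 fun i ↦ contDiffOn_pi.2 fun j ↦ hGsm i j
  have hGsym : ∀ z i j, Gh z i j = Gh z j i := fun z i j ↦ by
    rw [hGh]; exact chartGramMatrix_apply_comm h x z i j
  have hdetpos : ∀ y ∈ T, 0 < (Matrix.of (Gh y)).det := fun y hy ↦ by
    rw [hofG]
    exact Real.sqrt_pos.1 (sqrt_det_chartGramMatrix_pos h x (hTdef ▸ hy))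
  have hGdet : ContDiffOn ℝ ∞ (fun y ↦ (Matrix.of (Gh y)).det) T := by
    intro y hy
    have h1 := contMDiffAt_matrix_det (I := 𝓘(ℝ, EuclideanSpace ℝ (Fin m))) (k := ∞)
      (A := fun y ↦ Matrix.of (Gh y)) (x₀ := y)
      (fun i j ↦ contMDiffAt_iff_contDiffAt.2 ((hGsm i j).contDiffAt (hT.mem_nhds hy)))
    exact (contMDiffAt_iff_contDiffAt.1 h1).contDiffWithinAt
  have hρ : ContDiffOn ℝ ∞ (fun y ↦ Real.sqrt (Matrix.of (Gh y)).det) T :=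
    hGdet.sqrt fun y hy ↦ (hdetpos y hy).ne'
  have hGinv : ∀ i l, ContDiffOn ℝ ∞ (fun y ↦ (Matrix.of (Gh y))⁻¹ i l) T := by
    intro i l y hy
    have h1 := contMDiffAt_matrix_inv (I := 𝓘(ℝ, EuclideanSpace ℝ (Fin m))) (k := ∞)
      (A := fun y ↦ Matrix.of (Gh y)) (x₀ := y)
      (fun i j ↦ contMDiffAt_iff_contDiffAt.2 ((hGsm i j).contDiffAt (hT.mem_nhds hy)))
      (hdetpos y hy).ne' i l
    exact (contMDiffAt_iff_contDiffAt.1 h1).contDiffWithinAt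
  -- the coefficients `a i j = √g G⁻¹ j i` and the fluxes `W j = ∑ᵢ a i j ∂ᵢψ`
  obtain ⟨a, ha⟩ : ∃ a : Fin m → Fin m → EuclideanSpace ℝ (Fin m) → ℝ,
      a = fun i j z ↦ Real.sqrt (Matrix.of (Gh z)).det * (Matrix.of (Gh z))⁻¹ j i := ⟨_, rfl⟩
  have haT : ∀ i j, ContDiffOn ℝ ∞ (a i j) T := fun i j ↦ by
    rw [ha]; exact hρ.mul (hGinv j i)
  obtain ⟨W, hWdef⟩ : ∃ W : Fin m → EuclideanSpace ℝ (Fin m) → ℝ, W = fun i y ↦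
      Real.sqrt (Matrix.of (Gh y)).det * ∑ l, (Matrix.of (Gh y))⁻¹ i l * fderiv ℝ ψ y (b l) :=
    ⟨_, rfl⟩
  have hWa : ∀ j, W j = fun z ↦ ∑ i, a i j z * fderiv ℝ ψ z (b i) := by
    intro j
    rw [hWdef, ha]
    funext z
    dsimp only
    rw [Finset.mul_sum]
    refine Finset.sum_congr rfl fun i _ ↦ ?_
    ring
  have hdψ : ∀ l, ContDiff ℝ ∞ (fun y ↦ fderiv ℝ ψ y (b l)) := fun l ↦
    (hψ.fderiv_right (m := ∞) (by exact_mod_cast le_top)).clm_apply contDiff_const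
  have hmemS : ∀ y ∈ T, (extChartAt I x).symm y ∈ (chartAt H x).source := fun y hy ↦ by
    rw [hsrc]; exact (extChartAt I x).map_target (hTdef ▸ hy)
  have hright : ∀ y ∈ T, extChartAt I x ((extChartAt I x).symm y) = y := fun y hy ↦
    (extChartAt I x).right_inv (hTdef ▸ hy)
  have hTnhds : ∀ y ∈ T, T ∈ 𝓝 y := fun y hy ↦ hT.mem_nhds hy
  -- (1) the Laplacian of `ζ` in the chart, in divergence form: `√g Δζ ∘ φ⁻¹ = ∑ᵢ ∂ᵢ Wᵢ` on `T`
  have hΔ : ∀ y ∈ T, Real.sqrt (Matrix.of (Gh y)).det *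
      (ofRiemannian h).dalembertian ζ ((extChartAt I x).symm y) = ∑ i, fderiv ℝ (W i) y (b i) := by
    intro y hy
    have hGy : HasFDerivAt Gh (fderiv ℝ Gh y) y :=
      ((hGpi.contDiffAt (hTnhds y hy)).differentiableAt (by simp)).hasFDerivAt
    have hf2y : HasFDerivAt (fun z ↦ fderiv ℝ ψ z) (fderiv ℝ (fderiv ℝ ψ) y) y :=
      (((hψ2.fderiv_right (m := 1) (by norm_num)).contDiffAt).differentiableAt
        one_ne_zero).hasFDerivAt
    have hL := dalembertian_eq_sum_localFrame (ofRiemannian h) b (hmemS y hy)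
      (hζs ((extChartAt I x).symm y)) (Gh := Gh) (fh := ψ) (by
        rw [hright y hy]
        filter_upwards [hTnhds y hy] with z hz
        exact hGT z hz) (by
        rw [hright y hy]
        filter_upwards [hTnhds y hy] with z hz
        rw [Function.comp_apply, hζT z hz])
    rw [hright y hy] at hL
    have hC := Literature.Analysis.Calculus.coordLaplacian_mul_sqrt_det_eq_sum_fderiv b hGy hGsym
      (hdetpos y hy) hf2y
    rw [hL]
    simp only [Literature.Analysis.Calculus.fderiv_apply_apply_eq hGy] at hC ⊢
    rw [hC, hWdef]
  -- (2) `∑ⱼ ∂ⱼ Wⱼ = ∑ᵢⱼ ∂ⱼ(a i j ∂ᵢψ)` on `T`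
  have hdiv : ∀ y ∈ T, ∑ j, fderiv ℝ (W j) y (b j) =
      ∑ i, ∑ j, fderiv ℝ (fun z ↦ a i j z * fderiv ℝ ψ z (b i)) y (b j) := by
    intro y hy
    rw [Finset.sum_comm]
    refine Finset.sum_congr rfl fun j _ ↦ ?_
    rw [hWa j, fderiv_fun_sum fun i _ ↦ ?_]
    · simp only [FunLike.coe_sum, Finset.sum_apply]
    · exact (((haT i j).contDiffAt (hTnhds y hy)).differentiableAt (by simp)).mul
        ((hdψ i).differentiable (by simp) y)
  -- (3) the left-hand side in the chart
  haveI : IsFiniteMeasureOnCompacts (riemannianMeasure h) :=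
    ⟨fun K hK ↦ riemannianVolume_lt_top_of_isCompact_holds h le_rfl hK⟩
  have hΔc : Continuous ((ofRiemannian h).dalembertian ζ) := continuous_dalembertian _ hζs
  have hζcont : Continuous ζ := hζs.continuous
  have hsuppL : support (fun p ↦ u p * ((ofRiemannian h).dalembertian ζ p - f p * ζ p)) ⊆
      (extChartAt I x).source := by
    intro p hp
    rw [mem_support] at hp
    have hp' : (ofRiemannian h).dalembertian ζ p - f p * ζ p ≠ 0 := right_ne_zero_of_mul hp
    refine hζsupp (by_contra fun hnot ↦ hp' ?_)
    rw [dalembertian_eq_zero_of_notMem_tsupport _ hnot, image_eq_zero_of_notMem_tsupport hnot,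
      mul_zero, sub_zero]
  have hLHS : ∫ p, u p * ((ofRiemannian h).dalembertian ζ p - f p * ζ p) ∂riemannianMeasure h =
      ∫ y in T, u ((extChartAt I x).symm y) *
        ((∑ i, ∑ j, fderiv ℝ (fun z ↦ a i j z * fderiv ℝ ψ z (b i)) y (b j)) -
          (Real.sqrt (Matrix.of (Gh y)).det * f ((extChartAt I x).symm y)) * ψ y) := by
    have hmeas : Measurable (fun p ↦ u p * ((ofRiemannian h).dalembertian ζ p - f p * ζ p)) :=
      hum.mul (hΔc.sub (hf.mul hζcont)).measurable
    rw [integral_eq_integral_chart h x hmeas hsuppL, ← hTdef]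
    refine setIntegral_congr_fun hTm (fun y hy ↦ ?_)
    rw [smul_eq_mul, ← hofG, hζT y hy, ← hdiv y hy, ← hΔ y hy]
    ring
  -- (4) the right-hand side in the chart
  have hsuppR : support (fun p ↦ g p * ζ p) ⊆ (extChartAt I x).source := by
    intro p hp
    rw [mem_support] at hp
    exact hζsupp (subset_tsupport _ (right_ne_zero_of_mul hp))
  have hRHS : ∫ p, g p * ζ p ∂riemannianMeasure h =
      ∫ y in T, (Real.sqrt (Matrix.of (Gh y)).det * g ((extChartAt I x).symm y)) * ψ y := by
    have hmR : Measurable (fun p ↦ g p * ζ p) := (hg.mul hζcont).measurable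
    rw [integral_eq_integral_chart h x hmR hsuppR, ← hTdef]
    refine setIntegral_congr_fun hTm (fun y hy ↦ ?_)
    rw [smul_eq_mul, ← hofG, hζT y hy]
    ring
  -- (5) both target integrands vanish off `tsupport ψ ⊆ T`
  have hvan : ∀ y ∉ T, ∀ i j, fderiv ℝ (fun z ↦ a i j z * fderiv ℝ ψ z (b i)) y (b j) = 0 := by
    intro y hy i j
    have hy' : y ∉ tsupport ψ := fun h' ↦ hy (hψT' h')
    have hev : (fun z ↦ a i j z * fderiv ℝ ψ z (b i)) =ᶠ[𝓝 y] fun _ ↦ 0 := by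
      have h0 : ∀ᶠ z in 𝓝 y, z ∉ tsupport ψ :=
        (isClosed_tsupport ψ).isOpen_compl.mem_nhds hy'
      filter_upwards [h0] with z hz
      have : z ∉ tsupport (fderiv ℝ ψ) := fun h' ↦ hz (tsupport_fderiv_subset ℝ h')
      rw [image_eq_zero_of_notMem_tsupport this, zero_apply, mul_zero]
    rw [hev.fderiv_eq, fderiv_const_apply, zero_apply]
  have hψ0 : ∀ y ∉ T, ψ y = 0 := fun y hy ↦
    image_eq_zero_of_notMem_tsupport fun h' ↦ hy (hψT' h')
  rw [hLHS, hRHS] at hW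
  rw [setIntegral_eq_integral_of_forall_compl_eq_zero (s := T) (fun y hy ↦ by
      simp only [hvan y hy, Finset.sum_const_zero, hψ0 y hy, mul_zero, sub_zero]),
    setIntegral_eq_integral_of_forall_compl_eq_zero (s := T) (fun y hy ↦ by
      rw [hψ0 y hy, mul_zero])] at hW
  rw [ha] at hW
  simpa only [hofG] using hW

end ChartIdentity

/-! ### Local and global smooth representatives (smooth test functions) -/

section Assembly

variable {m : ℕ} {N : Type*} [TopologicalSpace N] [ChartedSpace (EuclideanSpace ℝ (Fin m)) N]
  [IsManifold (𝓡 m) ∞ N] [T2Space N] [LocallyCompactSpace N]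
  [MeasurableSpace N] [BorelSpace N]
  (h : ContMDiffRiemannianMetric (𝓡 m) ∞ (EuclideanSpace ℝ (Fin m)) (TangentSpace (𝓡 m) : N → Type _))
  [(ofRiemannian h).HasLeviCivita]

/-- **Interior regularity on the manifold, locally, for the equation tested against smooth
functions** (Folland 1995, Cor. (6.34), the tree's theorem `Folland1995_cor634_holds`): if `u` is
measurable and locally integrable, `f, g ∈ C^∞(N)`, and `∫ u (Δ_h ζ − f ζ) dμ_h = ∫ g ζ dμ_h` for
all `ζ ∈ C^∞_c(N)`, then every point has an open neighbourhood on which `u` agrees a.e. with a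
`C^∞` function. Same proof as `exists_contMDiffOn_ae_eq_of_veryWeak` (`WeakSolutionRegularity.lean`)
through `integral_comp_extChartAt_symm_divForm_of_veryWeak_smooth`. [cite: Folland2020, Cor. (6.34)] -/
theorem exists_contMDiffOn_ae_eq_of_veryWeak_smooth [Nontrivial (EuclideanSpace ℝ (Fin m))]
    {u : N → ℝ} (hum : Measurable u) (hu : LocallyIntegrable u (riemannianMeasure h))
    {f g : N → ℝ} (hf : ContMDiff (𝓡 m) 𝓘(ℝ, ℝ) ∞ f) (hg : ContMDiff (𝓡 m) 𝓘(ℝ, ℝ) ∞ g)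
    (hweak : ∀ ζ : N → ℝ, ContMDiff (𝓡 m) 𝓘(ℝ, ℝ) ∞ ζ → HasCompactSupport ζ →
      ∫ p, u p * ((ofRiemannian h).dalembertian ζ p - f p * ζ p) ∂riemannianMeasure h =
        ∫ p, g p * ζ p ∂riemannianMeasure h) (x : N) :
    ∃ V : Set N, IsOpen V ∧ x ∈ V ∧ ∃ w : N → ℝ, ContMDiffOn (𝓡 m) 𝓘(ℝ, ℝ) ∞ w V ∧
      ∀ᵐ p ∂riemannianMeasure h, p ∈ V → u p = w p := by
  classical
  set b : Module.Basis (Fin m) ℝ (EuclideanSpace ℝ (Fin m)) := (EuclideanSpace.basisFun (Fin m) ℝ).toBasis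
    with hb_def
  have hT : IsOpen (extChartAt (𝓡 m) x).target := isOpen_extChartAt_target x
  have hρ := contDiffOn_sqrt_det_chartGramMatrix h x
  -- the Euclidean regularity theorem in the chart at `x`
  obtain ⟨U, hUo, hxU, hUT, w, hw, hae⟩ :=
    Literature.Analysis.Distribution.exists_contDiffOn_ae_eq_of_divForm_weak
      (volume : Measure (EuclideanSpace ℝ (Fin m))) b
      Literature.Analysis.Distribution.Folland1995_cor634_holds hT
      (a := fun i j z ↦ Real.sqrt (chartGramMatrix h x z).det * (chartGramMatrix h x z)⁻¹ j i)
      (fun i j ↦ hρ.mul (contDiffOn_inv_chartGramMatrix_apply h x j i))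
      (fun y hy v hv ↦ divFormCoeff_chart_pos h x hy v hv)
      (c := fun y ↦ Real.sqrt (chartGramMatrix h x y).det * f ((extChartAt (𝓡 m) x).symm y))
      (hρ.mul (contDiffOn_comp_extChartAt_symm hf))
      (G := fun y ↦ Real.sqrt (chartGramMatrix h x y).det * g ((extChartAt (𝓡 m) x).symm y))
      (hρ.mul (contDiffOn_comp_extChartAt_symm hg))
      (locallyIntegrableOn_comp_extChartAt_symm h x hum hu)
      (fun ψ hψ hψc hψT ↦ integral_comp_extChartAt_symm_divForm_of_veryWeak_smooth h x hum
        hf.continuous hg.continuous hweak hψ hψc hψT)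
      ((extChartAt (𝓡 m) x).map_source (mem_extChartAt_source x))
  -- pull back
  obtain ⟨V, hV⟩ : ∃ V : Set N, V = (extChartAt (𝓡 m) x).source ∩ extChartAt (𝓡 m) x ⁻¹' U :=
    ⟨_, rfl⟩
  have hVo : IsOpen V := by
    rw [hV]; exact (continuousOn_extChartAt x).isOpen_inter_preimage (isOpen_extChartAt_source x) hUo
  have hxV : x ∈ V := by rw [hV]; exact ⟨mem_extChartAt_source x, hxU⟩
  refine ⟨V, hVo, hxV, w ∘ extChartAt (𝓡 m) x, ?_, ?_⟩
  · have hwU : ContMDiffOn 𝓘(ℝ, EuclideanSpace ℝ (Fin m)) 𝓘(ℝ, ℝ) ∞ w U :=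
      contMDiffOn_iff_contDiffOn.2 hw
    have hφ0 : ContMDiffOn (𝓡 m) 𝓘(ℝ, EuclideanSpace ℝ (Fin m)) ∞ (extChartAt (𝓡 m) x)
        (extChartAt (𝓡 m) x).source := by
      rw [extChartAt_source]
      exact contMDiffOn_extChartAt
    have hφ : ContMDiffOn (𝓡 m) 𝓘(ℝ, EuclideanSpace ℝ (Fin m)) ∞ (extChartAt (𝓡 m) x) V := by
      rw [hV]
      exact hφ0.mono inter_subset_left
    exact hwU.comp hφ (fun p hp ↦ by rw [hV] at hp; exact hp.2)
  · have := ae_comp_extChartAt_of_ae_target h x (P := fun y ↦ u ((extChartAt (𝓡 m) x).symm y) = w y)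
      hae
    filter_upwards [this] with p hp hpV
    rw [hV] at hpV
    have h1 := hp hpV.1 hpV.2
    rw [(extChartAt (𝓡 m) x).left_inv hpV.1] at h1
    exact h1

/-- **From an `L¹_loc` distributional solution (smooth test functions) to a smooth classical
solution.** On a σ-compact Riemannian manifold `(N, h)` modelled on `ℝ^m` (`m ≥ 1`): if `u` is
measurable and locally integrable, `f, g ∈ C^∞(N)`, and `∫ u (Δ_h ζ − f ζ) dμ_h = ∫ g ζ dμ_h` for all
`ζ ∈ C^∞_c(N)`, then there is `v ∈ C^∞(N)` with `u = v` a.e. and `Δ_h v − f v = g` everywhere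
(local representatives `exists_contMDiffOn_ae_eq_of_veryWeak_smooth`, patching
`exists_contMDiff_ae_eq_of_forall_exists_nhds`, and `dalembertian_sub_mul_eq_of_veryWeak`).
[cite: Folland2020, Cor. (6.34)] [cite: GilbargTrudinger2001, Cor. 8.11] -/
theorem exists_contMDiff_ae_eq_and_dalembertian_eq_of_veryWeak_smooth
    [Nontrivial (EuclideanSpace ℝ (Fin m))] [SigmaCompactSpace N]
    {u : N → ℝ} (hum : Measurable u) (hu : LocallyIntegrable u (riemannianMeasure h))
    {f g : N → ℝ} (hf : ContMDiff (𝓡 m) 𝓘(ℝ, ℝ) ∞ f) (hg : ContMDiff (𝓡 m) 𝓘(ℝ, ℝ) ∞ g)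
    (hweak : ∀ ζ : N → ℝ, ContMDiff (𝓡 m) 𝓘(ℝ, ℝ) ∞ ζ → HasCompactSupport ζ →
      ∫ p, u p * ((ofRiemannian h).dalembertian ζ p - f p * ζ p) ∂riemannianMeasure h =
        ∫ p, g p * ζ p ∂riemannianMeasure h) :
    ∃ v : N → ℝ, ContMDiff (𝓡 m) 𝓘(ℝ, ℝ) ∞ v ∧ (∀ᵐ p ∂riemannianMeasure h, u p = v p) ∧
      ∀ p, (ofRiemannian h).dalembertian v p - f p * v p = g p := by
  haveI : (riemannianMeasure h).IsOpenPosMeasure := isOpenPosMeasure_riemannianMeasure h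
  obtain ⟨v, hv, hae⟩ := exists_contMDiff_ae_eq_of_forall_exists_nhds (m := m)
    (μ := riemannianMeasure h) (u := u)
    (exists_contMDiffOn_ae_eq_of_veryWeak_smooth h hum hu hf hg hweak)
  refine ⟨v, hv, hae, fun p ↦ ?_⟩
  -- the weak identity passes to the smooth representative
  have hweak' : ∀ ζ : N → ℝ, ContMDiff (𝓡 m) 𝓘(ℝ, ℝ) ∞ ζ → HasCompactSupport ζ →
      ∫ q, v q * ((ofRiemannian h).dalembertian ζ q - f q * ζ q) ∂riemannianMeasure h =
        ∫ q, g q * ζ q ∂riemannianMeasure h := by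
    intro ζ hζ hζc
    rw [← hweak ζ hζ hζc]
    refine integral_congr_ae ?_
    filter_upwards [hae] with q hq
    rw [hq]
  exact dalembertian_sub_mul_eq_of_veryWeak h hv hf.continuous hg.continuous hweak' p

end Assembly

/-! ### Weak existence in `L²` by Lax–Milgram on the completion of `C^∞(N)` -/

section Existence

variable {m : ℕ} {N : Type*} [TopologicalSpace N] [ChartedSpace (EuclideanSpace ℝ (Fin m)) N]
  [IsManifold (𝓡 m) ∞ N] [T2Space N] [CompactSpace N] [MeasurableSpace N] [BorelSpace N]
  (h : ContMDiffRiemannianMetric (𝓡 m) ∞ (EuclideanSpace ℝ (Fin m)) (TangentSpace (𝓡 m) : N → Type _))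
  [(ofRiemannian h).HasLeviCivita]

/-- `∫ ψ F dμ = ⟪ψ, F⟫_{L²}` for `ψ ∈ L²` (as a function) and `F ∈ L²(μ)`. [folklore] -/
private theorem integral_mul_eq_inner_toLp {X : Type*} [MeasurableSpace X] {μ : Measure X}
    {ψ : X → ℝ} (hψ : MemLp ψ 2 μ) (F : Lp ℝ 2 μ) :
    ∫ x, ψ x * F x ∂μ = @inner ℝ _ _ (hψ.toLp ψ) F := by
  rw [L2.inner_def]
  refine integral_congr_ae ?_
  filter_upwards [hψ.coeFn_toLp] with x hx
  rw [hx, RCLike.inner_apply, conj_trivial, mul_comm]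

/-- **Weak-star continuity of the pairing**: if `Fₙ → U` in `L²(μ)` and `ψ ∈ L²`, then
`∫ ψ Fₙ → ∫ ψ U`. [folklore] -/
private theorem tendsto_integral_mul_of_tendsto_L2 {X : Type*} [MeasurableSpace X] {μ : Measure X}
    {Fn : ℕ → Lp ℝ 2 μ} {U : Lp ℝ 2 μ} (hFU : Tendsto Fn atTop (𝓝 U)) {ψ : X → ℝ}
    (hψ : MemLp ψ 2 μ) :
    Tendsto (fun n ↦ ∫ x, ψ x * Fn n x ∂μ) atTop (𝓝 (∫ x, ψ x * U x ∂μ)) := by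
  simp_rw [integral_mul_eq_inner_toLp hψ]
  exact ((innerSL ℝ (hψ.toLp ψ)).continuous.tendsto U).comp hFU

/-- **Hölder `(2, 2)` for continuous functions on a compact space**:
`|∫ F φ ψ dμ| ≤ C √(∫ φ²) √(∫ ψ²)` when `|F| ≤ C`, `C ≥ 0`. [folklore] -/
private theorem abs_integral_mul_mul_le {X : Type*} [MeasurableSpace X] [TopologicalSpace X]
    [OpensMeasurableSpace X] [CompactSpace X] {μ : Measure X} [IsFiniteMeasure μ]
    {F φ ψ : X → ℝ} (hF : Continuous F) (hφ : Continuous φ) (hψ : Continuous ψ) {C : ℝ}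
    (hC0 : 0 ≤ C) (hC : ∀ x, |F x| ≤ C) :
    |∫ x, F x * φ x * ψ x ∂μ| ≤
      C * Real.sqrt (∫ x, φ x ^ 2 ∂μ) * Real.sqrt (∫ x, ψ x ^ 2 ∂μ) := by
  haveI : IsFiniteMeasureOnCompacts μ := inferInstance
  have hmem : ∀ {G : X → ℝ}, Continuous G → MemLp G (ENNReal.ofReal 2) μ := fun hG ↦ by
    rw [show ENNReal.ofReal 2 = 2 by norm_num]
    exact hG.memLp_of_hasCompactSupport (HasCompactSupport.of_compactSpace _)
  have hH := integral_mul_le_Lp_mul_Lq_of_nonneg (μ := μ) Real.HolderConjugate.two_two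
    (Eventually.of_forall fun x ↦ abs_nonneg (φ x)) (Eventually.of_forall fun x ↦ abs_nonneg (ψ x))
    (hmem hφ.abs) (hmem hψ.abs)
  have h2 : ∀ G : X → ℝ, (∫ x, |G x| ^ (2 : ℝ) ∂μ) ^ (1 / (2 : ℝ)) = Real.sqrt (∫ x, G x ^ 2 ∂μ) := by
    intro G
    rw [Real.sqrt_eq_rpow]
    congr 1
    refine integral_congr_ae (Eventually.of_forall fun x ↦ ?_)
    simp only
    rw [show (2 : ℝ) = ((2 : ℕ) : ℝ) by norm_num, Real.rpow_natCast, sq_abs]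
  rw [h2, h2] at hH
  have hint : Integrable (fun x ↦ |φ x| * |ψ x|) μ :=
    (hφ.abs.mul hψ.abs).integrable_of_hasCompactSupport (HasCompactSupport.of_compactSpace _)
  have hF' : Continuous fun x ↦ F x * φ x * ψ x := (hF.mul hφ).mul hψ
  calc |∫ x, F x * φ x * ψ x ∂μ| ≤ ∫ x, |F x * φ x * ψ x| ∂μ := abs_integral_le_integral_abs
    _ ≤ ∫ x, C * (|φ x| * |ψ x|) ∂μ := by
        refine integral_mono_of_nonneg (Eventually.of_forall fun x ↦ abs_nonneg _)
          (hint.const_mul C) (Eventually.of_forall fun x ↦ ?_)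
        show |F x * φ x * ψ x| ≤ C * (|φ x| * |ψ x|)
        rw [abs_mul, abs_mul, mul_assoc]
        exact mul_le_mul_of_nonneg_right (hC x) (mul_nonneg (abs_nonneg _) (abs_nonneg _))
    _ = C * ∫ x, |φ x| * |ψ x| ∂μ := integral_const_mul _ _
    _ ≤ C * (Real.sqrt (∫ x, φ x ^ 2 ∂μ) * Real.sqrt (∫ x, ψ x ^ 2 ∂μ)) :=
        mul_le_mul_of_nonneg_left hH hC0
    _ = C * Real.sqrt (∫ x, φ x ^ 2 ∂μ) * Real.sqrt (∫ x, ψ x ^ 2 ∂μ) := by ring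

set_option maxHeartbeats 800000 in
/-- **Weak solutions in `L²` for a coercive Schrödinger operator on a closed manifold**
(Lax–Milgram, Gilbarg–Trudinger Thm. 5.8, on the completion of `C^∞(N)` for the inner product
`∫ (h⁻¹(dφ, dψ) + φψ) dμ_h`). Let `(N, h)` be a compact Riemannian manifold without boundary,
`f, g` continuous, and suppose `c ∫ φ² dμ_h ≤ ∫ (h⁻¹(dφ, dφ) + f φ²) dμ_h` for all `φ ∈ C^∞(N)`
with `c > 0`. Then there is `u ∈ L²(N, μ_h)` with `∫ u (Δ_h ζ − f ζ) dμ_h = ∫ g ζ dμ_h` for every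
`ζ ∈ C^∞(N)`: the form `B(φ, ψ) = ∫ (h⁻¹(dφ, dψ) + f φ ψ)` is bounded and coercive
(`B(φ, φ) ≥ ‖φ‖²/(1 + (sup|f| + 1)/c)`), the functional `ψ ↦ −∫ g ψ` is bounded, the Lax–Milgram
solution is the `L²`-limit of a Cauchy sequence `v_n ∈ C^∞(N)`
(`exists_cauchySeq_tendsto_of_coercive`), and Green's identity
`∫ h⁻¹(dv_n, dζ) = −∫ v_n Δ_h ζ` (`integral_mul_dalembertian_eq_neg_integral_innerDual`) turns
`B(v_n, ζ) → −∫ g ζ` into the asserted identity. [cite: GilbargTrudinger2001, Thm. 5.8] -/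
theorem exists_weakSolution_of_coercive {f g : N → ℝ} (hf : Continuous f) (hg : Continuous g)
    {c : ℝ} (hc : 0 < c)
    (hcoer : ∀ φ : N → ℝ, ContMDiff (𝓡 m) 𝓘(ℝ, ℝ) ∞ φ →
      c * ∫ x, φ x ^ 2 ∂riemannianMeasure h ≤
        ∫ x, ((ofRiemannian h).innerDual x (mvfderiv (𝓡 m) φ x).toLinearMap
          (mvfderiv (𝓡 m) φ x).toLinearMap + f x * φ x ^ 2) ∂riemannianMeasure h) :
    ∃ u : N → ℝ, MemLp u 2 (riemannianMeasure h) ∧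
      ∀ ζ : N → ℝ, ContMDiff (𝓡 m) 𝓘(ℝ, ℝ) ∞ ζ →
        ∫ x, u x * ((ofRiemannian h).dalembertian ζ x - f x * ζ x) ∂riemannianMeasure h =
          ∫ x, g x * ζ x ∂riemannianMeasure h := by
  classical
  haveI : LocallyCompactSpace N := ChartedSpace.locallyCompactSpace (EuclideanSpace ℝ (Fin m)) N
  haveI hFact : Fact (1 ≤ (2 : ℝ≥0∞)) := ⟨by norm_num⟩
  set μ : Measure N := riemannianMeasure h with hμ
  haveI : IsFiniteMeasure μ := isFiniteMeasure_riemannianMeasure h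
  haveI : IsFiniteMeasureOnCompacts μ := inferInstance
  haveI : μ.IsOpenPosMeasure := isOpenPosMeasure_riemannianMeasure h
  have hcs : ∀ F : N → ℝ, HasCompactSupport F := fun F ↦ HasCompactSupport.of_compactSpace F
  have hint : ∀ {F : N → ℝ}, Continuous F → Integrable F μ := fun hF ↦ integrable_of_continuous h hF
  /- sup bounds for `f` -/
  obtain ⟨Cf, hCf0, hCf⟩ : ∃ C, 0 ≤ C ∧ ∀ x, |f x| ≤ C := by
    obtain ⟨C, hC⟩ := isCompact_univ.exists_bound_of_continuousOn hf.continuousOn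
    exact ⟨max C 0, le_max_right _ _, fun x ↦
      (le_max_left _ _).trans' (by simpa [Real.norm_eq_abs] using hC x (mem_univ x))⟩
  /- the Dirichlet pairing `P u w = ∫ h⁻¹(du, dw) dμ` -/
  obtain ⟨P, hP⟩ : ∃ P : (N → ℝ) → (N → ℝ) → ℝ, ∀ u w, P u w =
      ∫ x, (ofRiemannian h).innerDual x (mvfderiv (𝓡 m) u x).toLinearMap
        (mvfderiv (𝓡 m) w x).toLinearMap ∂μ := ⟨_, fun _ _ ↦ rfl⟩
  have hPcont : ∀ {u w : N → ℝ}, ContMDiff (𝓡 m) 𝓘(ℝ, ℝ) 1 u → ContMDiff (𝓡 m) 𝓘(ℝ, ℝ) 1 w →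
      Continuous (fun x ↦ (ofRiemannian h).innerDual x (mvfderiv (𝓡 m) u x).toLinearMap
        (mvfderiv (𝓡 m) w x).toLinearMap) :=
    fun hu hw ↦ continuous_innerDual_mvfderiv (ofRiemannian h) hu hw
  have hPint : ∀ {u w : N → ℝ}, ContMDiff (𝓡 m) 𝓘(ℝ, ℝ) 1 u → ContMDiff (𝓡 m) 𝓘(ℝ, ℝ) 1 w →
      Integrable (fun x ↦ (ofRiemannian h).innerDual x (mvfderiv (𝓡 m) u x).toLinearMap
        (mvfderiv (𝓡 m) w x).toLinearMap) μ := fun hu hw ↦ hint (hPcont hu hw)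
  have hPcomm : ∀ u w, P u w = P w u := fun u w ↦ by
    rw [hP, hP]
    exact integral_congr_ae (Eventually.of_forall fun x ↦
      PseudoRiemannianMetric.innerDual_comm (ofRiemannian h) x _ _)
  have hPadd : ∀ {u v w : N → ℝ}, ContMDiff (𝓡 m) 𝓘(ℝ, ℝ) 1 u → ContMDiff (𝓡 m) 𝓘(ℝ, ℝ) 1 v →
      ContMDiff (𝓡 m) 𝓘(ℝ, ℝ) 1 w → P (u + v) w = P u w + P v w := by
    intro u v w hu hv hw
    rw [hP, hP, hP, ← integral_add (hPint hu hw) (hPint hv hw)]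
    refine integral_congr_ae (Eventually.of_forall fun x ↦ ?_)
    show (ofRiemannian h).innerDual x (mvfderiv (𝓡 m) (u + v) x).toLinearMap
        (mvfderiv (𝓡 m) w x).toLinearMap = _
    rw [mvfderiv_add ((hu x).mdifferentiableAt one_ne_zero) ((hv x).mdifferentiableAt one_ne_zero)]
    simp only [ContinuousLinearMap.toLinearMap_add, PseudoRiemannianMetric.innerDual,
      LinearMap.add_apply]
  have hPsmul : ∀ {u w : N → ℝ} (a : ℝ), ContMDiff (𝓡 m) 𝓘(ℝ, ℝ) 1 u →
      P (a • u) w = a * P u w := by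
    intro u w a hu
    rw [hP, hP, ← integral_const_mul]
    refine integral_congr_ae (Eventually.of_forall fun x ↦ ?_)
    have hsm : mvfderiv (𝓡 m) (a • u) x = a • mvfderiv (𝓡 m) u x := by
      ext v
      simp [mvfderiv, const_smul_mfderiv ((hu x).mdifferentiableAt one_ne_zero) a]
      rfl
    show (ofRiemannian h).innerDual x (mvfderiv (𝓡 m) (a • u) x).toLinearMap
        (mvfderiv (𝓡 m) w x).toLinearMap = _
    rw [hsm]
    simp only [ContinuousLinearMap.toLinearMap_smul, PseudoRiemannianMetric.innerDual,
      LinearMap.smul_apply, smul_eq_mul]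
  have hPnonneg : ∀ u, 0 ≤ P u u := fun u ↦ by
    rw [hP]; exact integral_nonneg fun x ↦ innerDual_self_nonneg h x _
  /- the test space `W = C^∞(N)` -/
  obtain ⟨W, hW⟩ : ∃ W : Submodule ℝ (ContMDiffMap (𝓡 m) 𝓘(ℝ, ℝ) N ℝ ∞), W = ⊤ := ⟨_, rfl⟩
  obtain ⟨ev, hev⟩ : ∃ ev : W → N → ℝ, ∀ φ, ev φ = ⇑(φ : ContMDiffMap (𝓡 m) 𝓘(ℝ, ℝ) N ℝ ∞) :=
    ⟨_, fun _ ↦ rfl⟩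
  have hevs : ∀ φ : W, ContMDiff (𝓡 m) 𝓘(ℝ, ℝ) ∞ (ev φ) := fun φ ↦ by
    rw [hev]; exact (φ : ContMDiffMap (𝓡 m) 𝓘(ℝ, ℝ) N ℝ ∞).contMDiff
  have hev1 : ∀ φ : W, ContMDiff (𝓡 m) 𝓘(ℝ, ℝ) 1 (ev φ) := fun φ ↦
    (hevs φ).of_le (WithTop.coe_le_coe.mpr le_top)
  have hevcont : ∀ φ : W, Continuous (ev φ) := fun φ ↦ (hevs φ).continuous
  have hev_add : ∀ φ ψ : W, ev (φ + ψ) = ev φ + ev ψ := fun φ ψ ↦ by rw [hev, hev, hev]; rfl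
  have hev_smul : ∀ (a : ℝ) (φ : W), ev (a • φ) = a • ev φ := fun a φ ↦ by rw [hev, hev]; rfl
  have hev_sub : ∀ φ ψ : W, ev (φ - ψ) = ev φ - ev ψ := fun φ ψ ↦ by rw [hev, hev, hev]; rfl
  have hev_zero : ev 0 = 0 := by rw [hev]; rfl
  have hev_inj : ∀ φ ψ : W, ev φ = ev ψ → φ = ψ := fun φ ψ h ↦ by
    rw [hev, hev] at h
    exact Subtype.ext (DFunLike.coe_injective h)
  have hev_mk : ∀ ζ : N → ℝ, ContMDiff (𝓡 m) 𝓘(ℝ, ℝ) ∞ ζ → ∃ φ : W, ev φ = ζ := fun ζ hζ ↦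
    ⟨⟨⟨ζ, hζ⟩, by rw [hW]; trivial⟩, by rw [hev]; rfl⟩
  /- `L²` quantities of test functions -/
  have hsq_int : ∀ φ : W, Integrable (fun x ↦ ev φ x ^ 2) μ := fun φ ↦ hint ((hevcont φ).pow 2)
  have hprod_int : ∀ φ ψ : W, Integrable (fun x ↦ ev φ x * ev ψ x) μ := fun φ ψ ↦
    hint ((hevcont φ).mul (hevcont ψ))
  obtain ⟨S, hS⟩ : ∃ S : W → ℝ, ∀ φ, S φ = ∫ x, ev φ x ^ 2 ∂μ := ⟨_, fun _ ↦ rfl⟩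
  have hS0 : ∀ φ, 0 ≤ S φ := fun φ ↦ by rw [hS]; exact integral_nonneg fun x ↦ sq_nonneg _
  /- the inner product `⟨φ, ψ⟩ = P φ ψ + ∫ φ ψ` on `W` -/
  have hip_add : ∀ φ ψ χ : W, P (ev (φ + ψ)) (ev χ) + ∫ x, ev (φ + ψ) x * ev χ x ∂μ =
      (P (ev φ) (ev χ) + ∫ x, ev φ x * ev χ x ∂μ) + (P (ev ψ) (ev χ) + ∫ x, ev ψ x * ev χ x ∂μ) := by
    intro φ ψ χ
    rw [hev_add, hPadd (hev1 φ) (hev1 ψ) (hev1 χ)]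
    have : ∫ x, (ev φ + ev ψ) x * ev χ x ∂μ = ∫ x, ev φ x * ev χ x ∂μ + ∫ x, ev ψ x * ev χ x ∂μ := by
      rw [← integral_add (hprod_int φ χ) (hprod_int ψ χ)]
      exact integral_congr_ae (Eventually.of_forall fun x ↦ by simp only [Pi.add_apply]; ring)
    rw [this]; ring
  have hip_smul : ∀ (a : ℝ) (φ χ : W), P (ev (a • φ)) (ev χ) + ∫ x, ev (a • φ) x * ev χ x ∂μ =
      a * (P (ev φ) (ev χ) + ∫ x, ev φ x * ev χ x ∂μ) := by
    intro a φ χ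
    rw [hev_smul, hPsmul a (hev1 φ)]
    have : ∫ x, (a • ev φ) x * ev χ x ∂μ = a * ∫ x, ev φ x * ev χ x ∂μ := by
      rw [← integral_const_mul]
      exact integral_congr_ae (Eventually.of_forall fun x ↦ by
        simp only [Pi.smul_apply, smul_eq_mul]; ring)
    rw [this]; ring
  have hip_self : ∀ φ : W, ∫ x, ev φ x * ev φ x ∂μ = S φ := fun φ ↦ by
    rw [hS]; exact integral_congr_ae (Eventually.of_forall fun x ↦ by ring)
  have hip_def : ∀ φ : W, P (ev φ) (ev φ) + ∫ x, ev φ x * ev φ x ∂μ = 0 → φ = 0 := by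
    intro φ h0
    rw [hip_self] at h0
    have hS00 : S φ = 0 := le_antisymm (by linarith [hPnonneg (ev φ), hS0 φ]) (hS0 φ)
    rw [hS] at hS00
    have hae := (integral_eq_zero_iff_of_nonneg (fun x ↦ sq_nonneg _) (hsq_int φ)).1 hS00
    have hfun : (fun x ↦ ev φ x ^ 2) = fun _ ↦ (0 : ℝ) :=
      (Continuous.ae_eq_iff_eq μ ((hevcont φ).pow 2) continuous_const).1 hae
    apply hev_inj
    rw [hev_zero]
    funext x
    have hx := congr_fun hfun x
    simpa using hx
  obtain ⟨core, hcore⟩ : ∃ core : InnerProductSpace.Core ℝ W,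
      ∀ φ ψ, core.inner φ ψ = P (ev φ) (ev ψ) + ∫ x, ev φ x * ev ψ x ∂μ :=
    ⟨{ inner := fun φ ψ ↦ P (ev φ) (ev ψ) + ∫ x, ev φ x * ev ψ x ∂μ
       conj_inner_symm := fun φ ψ ↦ by
         simp only [conj_trivial]
         rw [hPcomm (ev φ) (ev ψ)]
         congr 1
         exact integral_congr_ae (Eventually.of_forall fun x ↦ by ring)
       re_inner_nonneg := fun φ ↦ by
         simp only [RCLike.re_to_real]
         rw [hip_self]
         exact add_nonneg (hPnonneg (ev φ)) (hS0 φ)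
       add_left := hip_add
       smul_left := fun φ ψ r ↦ by simpa using hip_smul r φ ψ
       definite := hip_def }, fun _ _ ↦ rfl⟩
  letI i1 : NormedAddCommGroup W := @InnerProductSpace.Core.toNormedAddCommGroup ℝ W _ _ _ core
  letI i2 : InnerProductSpace ℝ W := InnerProductSpace.ofCore core.toCore
  have hinner : ∀ φ ψ : W, @inner ℝ W _ φ ψ = P (ev φ) (ev ψ) + ∫ x, ev φ x * ev ψ x ∂μ :=
    fun φ ψ ↦ hcore φ ψ
  have hnormsq : ∀ φ : W, ‖φ‖ ^ 2 = P (ev φ) (ev φ) + S φ := fun φ ↦ by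
    rw [← real_inner_self_eq_norm_sq, hinner, hip_self]
  -- `√(∫ φ²) ≤ ‖φ‖`
  have hSle : ∀ φ : W, Real.sqrt (S φ) ≤ ‖φ‖ := fun φ ↦ by
    rw [Real.sqrt_le_left (norm_nonneg _), hnormsq]
    linarith [hPnonneg (ev φ)]
  /- the bilinear form `B₀ φ ψ = P φ ψ + ∫ f φ ψ` and the functional `ℓ₀ ψ = −∫ g ψ` -/
  have hq_int : ∀ φ ψ : W, Integrable (fun x ↦ f x * ev φ x * ev ψ x) μ := fun φ ψ ↦
    hint ((hf.mul (hevcont φ)).mul (hevcont ψ))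
  have hq_add : ∀ φ ψ χ : W, ∫ x, f x * ev (φ + ψ) x * ev χ x ∂μ =
      ∫ x, f x * ev φ x * ev χ x ∂μ + ∫ x, f x * ev ψ x * ev χ x ∂μ := by
    intro φ ψ χ
    rw [← integral_add (hq_int φ χ) (hq_int ψ χ), hev_add]
    refine integral_congr_ae (Eventually.of_forall fun x ↦ ?_)
    simp only [Pi.add_apply]; ring
  have hq_smul : ∀ (a : ℝ) (φ χ : W), ∫ x, f x * ev (a • φ) x * ev χ x ∂μ =
      a * ∫ x, f x * ev φ x * ev χ x ∂μ := by
    intro a φ χ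
    rw [← integral_const_mul, hev_smul]
    refine integral_congr_ae (Eventually.of_forall fun x ↦ ?_)
    simp only [Pi.smul_apply, smul_eq_mul]; ring
  have hq_symm : ∀ φ ψ : W, ∫ x, f x * ev φ x * ev ψ x ∂μ = ∫ x, f x * ev ψ x * ev φ x ∂μ :=
    fun φ ψ ↦ integral_congr_ae (Eventually.of_forall fun x ↦ by ring)
  have hq_bound : ∀ φ ψ : W, |∫ x, f x * ev φ x * ev ψ x ∂μ| ≤ Cf * ‖φ‖ * ‖ψ‖ := by
    intro φ ψ
    have h1 := abs_integral_mul_mul_le (μ := μ) hf (hevcont φ) (hevcont ψ) hCf0 hCf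
    rw [← hS, ← hS] at h1
    calc |∫ x, f x * ev φ x * ev ψ x ∂μ| ≤ Cf * Real.sqrt (S φ) * Real.sqrt (S ψ) := h1
      _ ≤ Cf * ‖φ‖ * ‖ψ‖ := by
          have := hSle φ; have := hSle ψ
          have h0 : 0 ≤ Real.sqrt (S φ) := Real.sqrt_nonneg _
          have h0' : 0 ≤ Real.sqrt (S ψ) := Real.sqrt_nonneg _
          gcongr
  -- Cauchy–Schwarz for `P` alone: `|P φ ψ| ≤ 2 ‖φ‖ ‖ψ‖`
  have hone_bound : ∀ φ ψ : W, |∫ x, ev φ x * ev ψ x ∂μ| ≤ ‖φ‖ * ‖ψ‖ := by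
    intro φ ψ
    have h1 := abs_integral_mul_mul_le (μ := μ) (F := fun _ ↦ (1 : ℝ)) continuous_const
      (hevcont φ) (hevcont ψ) (C := 1) zero_le_one (fun _ ↦ by simp)
    simp only [one_mul] at h1
    rw [← hS, ← hS] at h1
    calc |∫ x, ev φ x * ev ψ x ∂μ| ≤ Real.sqrt (S φ) * Real.sqrt (S ψ) := h1
      _ ≤ ‖φ‖ * ‖ψ‖ := mul_le_mul (hSle φ) (hSle ψ) (Real.sqrt_nonneg _) (norm_nonneg _)
  have hP_bound : ∀ φ ψ : W, |P (ev φ) (ev ψ)| ≤ 2 * ‖φ‖ * ‖ψ‖ := by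
    intro φ ψ
    have hPe : P (ev φ) (ev ψ) = @inner ℝ W _ φ ψ - ∫ x, ev φ x * ev ψ x ∂μ := by
      rw [hinner]; ring
    rw [hPe]
    calc |@inner ℝ W _ φ ψ - ∫ x, ev φ x * ev ψ x ∂μ|
        ≤ |@inner ℝ W _ φ ψ| + |∫ x, ev φ x * ev ψ x ∂μ| := abs_sub _ _
      _ ≤ ‖φ‖ * ‖ψ‖ + ‖φ‖ * ‖ψ‖ := add_le_add (abs_real_inner_le_norm φ ψ) (hone_bound φ ψ)
      _ = 2 * ‖φ‖ * ‖ψ‖ := by ring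
  have hBex : ∃ B₀ : W →L[ℝ] W →L[ℝ] ℝ, ∀ φ ψ,
      B₀ φ ψ = P (ev φ) (ev ψ) + ∫ x, f x * ev φ x * ev ψ x ∂μ := by
    refine ⟨LinearMap.mkContinuous₂
      (LinearMap.mk₂ ℝ (fun φ ψ ↦ P (ev φ) (ev ψ) + ∫ x, f x * ev φ x * ev ψ x ∂μ) ?_ ?_ ?_ ?_)
        (2 + Cf) ?_, fun φ ψ ↦ rfl⟩
    · intro φ ψ χ
      rw [hev_add, hPadd (hev1 φ) (hev1 ψ) (hev1 χ), ← hev_add, hq_add]; ring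
    · intro a φ χ
      rw [hev_smul, hPsmul a (hev1 φ), ← hev_smul, hq_smul]; ring
    · intro φ ψ χ
      rw [hPcomm, hev_add, hPadd (hev1 ψ) (hev1 χ) (hev1 φ), hPcomm (ev ψ), hPcomm (ev χ),
        ← hev_add, hq_symm, hq_add, hq_symm χ, hq_symm ψ]; ring
    · intro a φ χ
      rw [hPcomm, hev_smul, hPsmul a (hev1 χ), hPcomm (ev χ), ← hev_smul, hq_symm, hq_smul,
        hq_symm]; ring
    · intro φ ψ
      simp only [LinearMap.mk₂_apply, Real.norm_eq_abs]
      calc |P (ev φ) (ev ψ) + ∫ x, f x * ev φ x * ev ψ x ∂μ|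
          ≤ |P (ev φ) (ev ψ)| + |∫ x, f x * ev φ x * ev ψ x ∂μ| := abs_add_le _ _
        _ ≤ 2 * ‖φ‖ * ‖ψ‖ + Cf * ‖φ‖ * ‖ψ‖ := add_le_add (hP_bound φ ψ) (hq_bound φ ψ)
        _ = (2 + Cf) * ‖φ‖ * ‖ψ‖ := by ring
  obtain ⟨B₀, hB₀⟩ := hBex
  -- the source functional
  obtain ⟨Cg, hCg0, hCg⟩ : ∃ C, 0 ≤ C ∧ ∀ x, |g x| ≤ C := by
    obtain ⟨C, hC⟩ := isCompact_univ.exists_bound_of_continuousOn hg.continuousOn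
    exact ⟨max C 0, le_max_right _ _, fun x ↦
      (le_max_left _ _).trans' (by simpa [Real.norm_eq_abs] using hC x (mem_univ x))⟩
  have hvol : 0 ≤ Real.sqrt (∫ x, (1 : ℝ) ^ 2 ∂μ) := Real.sqrt_nonneg _
  have hℓ_int : ∀ ψ : W, Integrable (fun x ↦ g x * ev ψ x) μ := fun ψ ↦ hint (hg.mul (hevcont ψ))
  have hℓ_bound : ∀ ψ : W, |∫ x, g x * ev ψ x ∂μ| ≤ Cg * Real.sqrt (∫ x, (1 : ℝ) ^ 2 ∂μ) * ‖ψ‖ := by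
    intro ψ
    have h1 := abs_integral_mul_mul_le (μ := μ) hg continuous_const (hevcont ψ) hCg0 hCg
      (φ := fun _ ↦ (1 : ℝ))
    simp only [mul_one] at h1
    rw [← hS] at h1
    have hCg0 : 0 ≤ Cg * Real.sqrt (∫ x, (1 : ℝ) ^ 2 ∂μ) := mul_nonneg hCg0 hvol
    calc |∫ x, g x * ev ψ x ∂μ| ≤ Cg * Real.sqrt (∫ x, (1 : ℝ) ^ 2 ∂μ) * Real.sqrt (S ψ) := h1
      _ ≤ Cg * Real.sqrt (∫ x, (1 : ℝ) ^ 2 ∂μ) * ‖ψ‖ := mul_le_mul_of_nonneg_left (hSle ψ) hCg0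
  have hℓex : ∃ ℓ₀ : W →L[ℝ] ℝ, ∀ ψ, ℓ₀ ψ = -∫ x, g x * ev ψ x ∂μ := by
    refine ⟨LinearMap.mkContinuous
      { toFun := fun ψ ↦ -∫ x, g x * ev ψ x ∂μ
        map_add' := ?_
        map_smul' := ?_ } (Cg * Real.sqrt (∫ x, (1 : ℝ) ^ 2 ∂μ)) ?_, fun ψ ↦ rfl⟩
    · intro φ ψ
      rw [hev_add, ← neg_add, ← integral_add (hℓ_int φ) (hℓ_int ψ)]
      congr 1
      refine integral_congr_ae (Eventually.of_forall fun x ↦ ?_)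
      simp only [Pi.add_apply]; ring
    · intro a ψ
      simp only [RingHom.id_apply, smul_eq_mul]
      rw [hev_smul, mul_neg, ← integral_const_mul]
      congr 1
      refine integral_congr_ae (Eventually.of_forall fun x ↦ ?_)
      simp only [Pi.smul_apply, smul_eq_mul]; ring
    · intro ψ
      simp only [LinearMap.coe_mk, AddHom.coe_mk, Real.norm_eq_abs, abs_neg]
      exact hℓ_bound ψ
  obtain ⟨ℓ₀, hℓ₀⟩ := hℓex
  /- coercivity: `B₀ φ φ ≥ m₀ ‖φ‖²` with `m₀ = (1 + Cf/c + 1/c)⁻¹` -/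
  set m₀ : ℝ := (1 + Cf / c + 1 / c)⁻¹ with hm₀
  have hden : 0 < 1 + Cf / c + 1 / c := by positivity
  have hm₀pos : 0 < m₀ := inv_pos.2 hden
  have hcoer' : ∀ φ : W, m₀ * ‖φ‖ ^ 2 ≤ B₀ φ φ := by
    intro φ
    -- `Q := B₀ φ φ = P φ φ + ∫ f φ²`
    have hQ : B₀ φ φ = P (ev φ) (ev φ) + ∫ x, f x * ev φ x ^ 2 ∂μ := by
      rw [hB₀]; congr 1
      exact integral_congr_ae (Eventually.of_forall fun x ↦ by ring)
    have hcφ : c * S φ ≤ B₀ φ φ := by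
      have hi2 : Integrable (fun x ↦ f x * ev φ x ^ 2) μ := hint (hf.mul ((hevcont φ).pow 2))
      rw [hQ, hS, hP, ← integral_add (hPint (hev1 φ) (hev1 φ)) hi2]
      exact hcoer (ev φ) (hevs φ)
    have hfφ : |∫ x, f x * ev φ x ^ 2 ∂μ| ≤ Cf * S φ := by
      rw [hS]
      calc |∫ x, f x * ev φ x ^ 2 ∂μ| ≤ ∫ x, |f x * ev φ x ^ 2| ∂μ := abs_integral_le_integral_abs
        _ ≤ ∫ x, Cf * ev φ x ^ 2 ∂μ := by
            refine integral_mono_of_nonneg (Eventually.of_forall fun x ↦ abs_nonneg _)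
              ((hsq_int φ).const_mul Cf) (Eventually.of_forall fun x ↦ ?_)
            show |f x * ev φ x ^ 2| ≤ Cf * ev φ x ^ 2
            rw [abs_mul, abs_pow, sq_abs]
            exact mul_le_mul_of_nonneg_right (hCf x) (sq_nonneg _)
        _ = Cf * ∫ x, ev φ x ^ 2 ∂μ := integral_const_mul _ _
    have hQ0 : 0 ≤ B₀ φ φ := le_trans (mul_nonneg hc.le (hS0 φ)) hcφ
    -- `P φ φ ≤ (1 + Cf/c) Q` and `S φ ≤ Q / c`
    have hPle : P (ev φ) (ev φ) ≤ (1 + Cf / c) * B₀ φ φ := by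
      have h1 : P (ev φ) (ev φ) = B₀ φ φ - ∫ x, f x * ev φ x ^ 2 ∂μ := by rw [hQ]; ring
      have h2 : -(∫ x, f x * ev φ x ^ 2 ∂μ) ≤ Cf * S φ := by
        have := neg_abs_le (∫ x, f x * ev φ x ^ 2 ∂μ); linarith [hfφ]
      have h3 : Cf * S φ ≤ Cf / c * B₀ φ φ := by
        rw [div_mul_eq_mul_div, le_div_iff₀ hc]
        nlinarith [hcφ, hCf0]
      linarith
    have hSle' : S φ ≤ 1 / c * B₀ φ φ := by
      rw [one_div, ← div_eq_inv_mul, le_div_iff₀ hc]; linarith [hcφ]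
    rw [hnormsq, hm₀]
    rw [inv_mul_le_iff₀ hden]
    nlinarith [hPle, hSle', hQ0]
  /- Lax–Milgram: a Cauchy sequence of test functions -/
  obtain ⟨v, hvC, hvB, L, -, -⟩ := exists_cauchySeq_tendsto_of_coercive B₀ ℓ₀ hm₀pos hcoer'
  /- passage to `L²` -/
  have hmem : ∀ φ : W, MemLp (ev φ) 2 μ := fun φ ↦
    (hevcont φ).memLp_of_hasCompactSupport (hcs _)
  obtain ⟨T, hT⟩ : ∃ T : W → Lp ℝ 2 μ, ∀ φ, T φ = (hmem φ).toLp (ev φ) := ⟨_, fun _ ↦ rfl⟩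
  have hTsub : ∀ φ ψ : W, T φ - T ψ = T (φ - ψ) := by
    intro φ ψ
    rw [hT, hT, hT, ← MemLp.toLp_sub (hmem φ) (hmem ψ)]
    exact MemLp.toLp_congr _ _ (by rw [hev_sub])
  have hTnorm : ∀ φ : W, ‖T φ‖ = Real.sqrt (S φ) := fun φ ↦ by
    rw [hT, Lp.norm_toLp, hS]
    exact Literature.Geometry.Riemannian.toReal_eLpNorm_two_eq_sqrt' (hsq_int φ)
  have hTle : ∀ φ : W, ‖T φ‖ ≤ ‖φ‖ := fun φ ↦ by rw [hTnorm]; exact hSle φ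
  have hTC : CauchySeq fun n ↦ T (v n) := by
    rw [Metric.cauchySeq_iff] at hvC ⊢
    intro ε hε
    obtain ⟨M, hM⟩ := hvC ε hε
    refine ⟨M, fun k hk n hn ↦ ?_⟩
    have hmn := hM k hk n hn
    rw [dist_eq_norm] at hmn ⊢
    rw [hTsub]
    exact (hTle _).trans_lt hmn
  obtain ⟨U, hU⟩ := cauchySeq_tendsto_of_complete hTC
  refine ⟨U, Lp.memLp U, ?_⟩
  /- the distributional identity -/
  intro ζ hζ
  obtain ⟨φζ, hφζ⟩ := hev_mk ζ hζ
  have hζ2 : ContMDiff (𝓡 m) 𝓘(ℝ, ℝ) 2 ζ := hζ.of_le (WithTop.coe_le_coe.mpr le_top)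
  have hζcont : Continuous ζ := hζ.continuous
  -- the test integrand `ψ = f ζ − Δ_h ζ`
  obtain ⟨ψ, hψ⟩ : ∃ ψ : N → ℝ, ψ = fun x ↦ f x * ζ x - (ofRiemannian h).dalembertian ζ x := ⟨_, rfl⟩
  have hΔc : Continuous ((ofRiemannian h).dalembertian ζ) := continuous_dalembertian _ hζ2
  have hψc : Continuous ψ := by rw [hψ]; exact (hf.mul hζcont).sub hΔc
  have hψ2 : MemLp ψ 2 μ := hψc.memLp_of_hasCompactSupport (hcs _)
  -- `B₀ (v n) φζ = ∫ ψ · v n`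
  have hBψ : ∀ n, B₀ (v n) φζ = ∫ x, ψ x * T (v n) x ∂μ := by
    intro n
    have hGreen : ∫ x, ev (v n) x * (ofRiemannian h).dalembertian ζ x ∂μ =
        -∫ x, (ofRiemannian h).innerDual x (mvfderiv (𝓡 m) (ev (v n)) x).toLinearMap
          (mvfderiv (𝓡 m) ζ x).toLinearMap ∂μ :=
      integral_mul_dalembertian_eq_neg_integral_innerDual h (hev1 (v n)) hζ2
    have hi1 : Integrable (fun x ↦ ev (v n) x * (ofRiemannian h).dalembertian ζ x) μ :=
      hint ((hevcont (v n)).mul hΔc)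
    have hi2 : Integrable (fun x ↦ f x * ev (v n) x * ζ x) μ := by
      have := hq_int (v n) φζ
      rwa [hφζ] at this
    have hae : (fun x ↦ ψ x * T (v n) x) =ᵐ[μ] fun x ↦ ψ x * ev (v n) x := by
      filter_upwards [show (T (v n) : N → ℝ) =ᵐ[μ] ev (v n) from by
        rw [hT]; exact (hmem (v n)).coeFn_toLp] with x hx
      rw [hx]
    rw [integral_congr_ae hae, hB₀, hP, hφζ]
    rw [show (∫ x, (ofRiemannian h).innerDual x (mvfderiv (𝓡 m) (ev (v n)) x).toLinearMap
        (mvfderiv (𝓡 m) ζ x).toLinearMap ∂μ) =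
        -∫ x, ev (v n) x * (ofRiemannian h).dalembertian ζ x ∂μ by rw [hGreen, neg_neg]]
    have hi1' : Integrable (fun x ↦ -(ev (v n) x * (ofRiemannian h).dalembertian ζ x)) μ := hi1.neg
    rw [← integral_neg, ← integral_add hi1' hi2]
    refine integral_congr_ae (Eventually.of_forall fun x ↦ ?_)
    rw [hψ]
    ring
  have hlim1 : Tendsto (fun n ↦ ∫ x, ψ x * T (v n) x ∂μ) atTop (𝓝 (∫ x, ψ x * U x ∂μ)) :=
    tendsto_integral_mul_of_tendsto_L2 hU hψ2
  have hlim2 : Tendsto (fun n ↦ ∫ x, ψ x * T (v n) x ∂μ) atTop (𝓝 (ℓ₀ φζ)) := by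
    have := hvB φζ
    simp_rw [hBψ] at this
    exact this
  have heq : ∫ x, ψ x * U x ∂μ = -∫ x, g x * ζ x ∂μ := by
    rw [tendsto_nhds_unique hlim1 hlim2, hℓ₀, hφζ]
  calc ∫ x, U x * ((ofRiemannian h).dalembertian ζ x - f x * ζ x) ∂μ
      = ∫ x, -(ψ x * U x) ∂μ := by
        refine integral_congr_ae (Eventually.of_forall fun x ↦ ?_)
        rw [hψ]; ring
    _ = ∫ x, g x * ζ x ∂μ := by rw [integral_neg, heq, neg_neg]

end Existence

/-! ### Smooth solutions, positivity -/

section Smooth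

variable {m : ℕ} {N : Type*} [TopologicalSpace N] [ChartedSpace (EuclideanSpace ℝ (Fin m)) N]
  [IsManifold (𝓡 m) ∞ N] [T2Space N] [CompactSpace N] [MeasurableSpace N] [BorelSpace N]
  (h : ContMDiffRiemannianMetric (𝓡 m) ∞ (EuclideanSpace ℝ (Fin m)) (TangentSpace (𝓡 m) : N → Type _))
  [(ofRiemannian h).HasLeviCivita]

/-- **Smooth solutions of `Δ_h v − f v = g` for a coercive Schrödinger form on a closed manifold.**
Let `(N, h)` be a compact Riemannian manifold without boundary modelled on `ℝ^m`, `m ≥ 1`,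
`f, g ∈ C^∞(N)`, and suppose `c ∫ φ² dμ_h ≤ ∫ (h⁻¹(dφ, dφ) + f φ²) dμ_h` for all `φ ∈ C^∞(N)` with
`c > 0`. Then there is `v ∈ C^∞(N)` with `Δ_h v − f v = g` at every point: the `L²` weak solution
of `exists_weakSolution_of_coercive` (Lax–Milgram) has a smooth representative solving the equation
classically (`exists_contMDiff_ae_eq_and_dalembertian_eq_of_veryWeak_smooth`: Folland 1995,
Cor. (6.34) in charts, patching, and the fundamental lemma of the calculus of variations).
[cite: GilbargTrudinger2001, Thm. 5.8 and Cor. 8.11] [cite: Folland2020, Cor. (6.34)] -/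
theorem exists_smooth_solution_of_coercive [Nontrivial (EuclideanSpace ℝ (Fin m))]
    {f g : N → ℝ} (hf : ContMDiff (𝓡 m) 𝓘(ℝ, ℝ) ∞ f) (hg : ContMDiff (𝓡 m) 𝓘(ℝ, ℝ) ∞ g)
    {c : ℝ} (hc : 0 < c)
    (hcoer : ∀ φ : N → ℝ, ContMDiff (𝓡 m) 𝓘(ℝ, ℝ) ∞ φ →
      c * ∫ x, φ x ^ 2 ∂riemannianMeasure h ≤
        ∫ x, ((ofRiemannian h).innerDual x (mvfderiv (𝓡 m) φ x).toLinearMap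
          (mvfderiv (𝓡 m) φ x).toLinearMap + f x * φ x ^ 2) ∂riemannianMeasure h) :
    ∃ v : N → ℝ, ContMDiff (𝓡 m) 𝓘(ℝ, ℝ) ∞ v ∧
      ∀ p, (ofRiemannian h).dalembertian v p - f p * v p = g p := by
  haveI : LocallyCompactSpace N := ChartedSpace.locallyCompactSpace (EuclideanSpace ℝ (Fin m)) N
  haveI : IsFiniteMeasure (riemannianMeasure h) := isFiniteMeasure_riemannianMeasure h
  obtain ⟨u, hu2, hweak⟩ := exists_weakSolution_of_coercive h hf.continuous hg.continuous hc hcoer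
  -- a measurable representative
  have hu'm : Measurable (hu2.1.mk u) := hu2.1.stronglyMeasurable_mk.measurable
  have hae : u =ᵐ[riemannianMeasure h] hu2.1.mk u := hu2.1.ae_eq_mk
  have hint : Integrable u (riemannianMeasure h) := hu2.integrable one_le_two
  have hloc : LocallyIntegrable (hu2.1.mk u) (riemannianMeasure h) :=
    (hint.congr hae).locallyIntegrable
  have hweak' : ∀ ζ : N → ℝ, ContMDiff (𝓡 m) 𝓘(ℝ, ℝ) ∞ ζ → HasCompactSupport ζ →
      ∫ p, hu2.1.mk u p * ((ofRiemannian h).dalembertian ζ p - f p * ζ p) ∂riemannianMeasure h =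
        ∫ p, g p * ζ p ∂riemannianMeasure h := by
    intro ζ hζ _
    rw [← hweak ζ hζ]
    refine integral_congr_ae ?_
    filter_upwards [hae] with x hx
    rw [hx]
  obtain ⟨v, hv, -, hpde⟩ :=
    exists_contMDiff_ae_eq_and_dalembertian_eq_of_veryWeak_smooth h hu'm hloc hf hg hweak'
  exact ⟨v, hv, hpde⟩

/-- **Positivity of solutions for a negative source.** On a compact Riemannian manifold `(N, h)`
without boundary let `f` be continuous with `c ∫ φ² ≤ ∫ (h⁻¹(dφ, dφ) + f φ²)` for all `φ ∈ C^∞(N)`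
(`c > 0`), and let `v ∈ C^∞(N)` solve `Δ_h v − f v = g` with `g < 0` everywhere. Then `v > 0`
everywhere. Proof: (1) `v ≥ 0`: for `δ > 0` the functions `ρ = √(v² + δ²)`,
`φ = (ρ − v)/2 ≥ v⁻ ≥ 0` are smooth with `dφ = −(φ/ρ) dv`, `0 ≤ φ/ρ ≤ 1`, whence
`|dφ|² ≤ −h⁻¹(dv, dφ)` pointwise; by Green's identity and the equation
`−∫ h⁻¹(dv, dφ) = ∫ φ Δ_h v = ∫ φ (g + f v) ≤ ∫ f v φ`, so coercivity at `φ` gives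
`c ∫ (v⁻)² ≤ c ∫ φ² ≤ ∫ f φ (v + φ) = (δ²/4) ∫ f → 0`, i.e. `v⁻ = 0`. (2) At a zero of `v ≥ 0`
(a minimum) `Δ_h v ≥ 0` (`laplaceBeltrami_nonpos_of_isMaxOn` for `−v`), contradicting
`Δ_h v = g + f v = g < 0` there. (The variational substitute for the strong maximum principle in
Gursky–LeBrun 1998, proof of Prop. 3.) [cite: GurskyLebrun1998, Prop. 3 (proof)] -/
theorem pos_of_dalembertian_sub_mul_eq_of_coercive {f g : N → ℝ} (hf : Continuous f)
    {c : ℝ} (hc : 0 < c)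
    (hcoer : ∀ φ : N → ℝ, ContMDiff (𝓡 m) 𝓘(ℝ, ℝ) ∞ φ →
      c * ∫ x, φ x ^ 2 ∂riemannianMeasure h ≤
        ∫ x, ((ofRiemannian h).innerDual x (mvfderiv (𝓡 m) φ x).toLinearMap
          (mvfderiv (𝓡 m) φ x).toLinearMap + f x * φ x ^ 2) ∂riemannianMeasure h)
    {v : N → ℝ} (hv : ContMDiff (𝓡 m) 𝓘(ℝ, ℝ) ∞ v)
    (hpde : ∀ p, (ofRiemannian h).dalembertian v p - f p * v p = g p) (hg : ∀ p, g p < 0)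
    (p : N) : 0 < v p := by
  haveI : LocallyCompactSpace N := ChartedSpace.locallyCompactSpace (EuclideanSpace ℝ (Fin m)) N
  set μ : Measure N := riemannianMeasure h with hμ
  haveI : IsFiniteMeasure μ := isFiniteMeasure_riemannianMeasure h
  haveI : μ.IsOpenPosMeasure := isOpenPosMeasure_riemannianMeasure h
  have hint : ∀ {F : N → ℝ}, Continuous F → Integrable F μ := fun hF ↦ integrable_of_continuous h hF
  have hv1 : ContMDiff (𝓡 m) 𝓘(ℝ, ℝ) 1 v := hv.of_le (WithTop.coe_le_coe.mpr le_top)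
  have hv2 : ContMDiff (𝓡 m) 𝓘(ℝ, ℝ) 2 v := hv.of_le (WithTop.coe_le_coe.mpr le_top)
  have hvc : Continuous v := hv.continuous
  have hgc : Continuous g := by
    have : g = fun q ↦ (ofRiemannian h).dalembertian v q - f q * v q := funext fun q ↦ (hpde q).symm
    rw [this]
    exact (continuous_dalembertian _ hv2).sub (hf.mul hvc)
  /- Step 1: `v ≥ 0` -/
  have hnonneg : ∀ x, 0 ≤ v x := by
    -- the negative part `w = v⁻`
    obtain ⟨w, hwdef⟩ : ∃ w : N → ℝ, w = fun x ↦ (|v x| - v x) / 2 := ⟨_, rfl⟩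
    have hwc : Continuous w := by rw [hwdef]; exact (hvc.abs.sub hvc).div_const _
    have hw0 : ∀ x, 0 ≤ w x := fun x ↦ by
      rw [hwdef]; have := le_abs_self (v x); dsimp only; linarith
    -- the key estimate for every `δ > 0`
    have hkey : ∀ δ : ℝ, 0 < δ → c * ∫ x, w x ^ 2 ∂μ ≤ δ ^ 2 / 4 * ∫ x, |f x| ∂μ := by
      intro δ hδ
      obtain ⟨ρ, hρdef⟩ : ∃ ρ : N → ℝ, ρ = fun x ↦ Real.sqrt (v x ^ 2 + δ ^ 2) := ⟨_, rfl⟩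
      obtain ⟨φ, hφdef⟩ : ∃ φ : N → ℝ, φ = fun x ↦ (ρ x - v x) / 2 := ⟨_, rfl⟩
      have hin : ∀ x, 0 < v x ^ 2 + δ ^ 2 := fun x ↦ by positivity
      have hρpos : ∀ x, 0 < ρ x := fun x ↦ by rw [hρdef]; exact Real.sqrt_pos.2 (hin x)
      have hρge : ∀ x, |v x| ≤ ρ x := fun x ↦ by
        rw [hρdef]; exact Real.abs_le_sqrt (by nlinarith)
      have hφ0 : ∀ x, 0 ≤ φ x := fun x ↦ by
        rw [hφdef]; have := hρge x; have := le_abs_self (v x); dsimp only; linarith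
      have hφle : ∀ x, φ x ≤ ρ x := fun x ↦ by
        rw [hφdef]; have := hρge x; have := neg_abs_le (v x); dsimp only; linarith
      have hwφ : ∀ x, w x ≤ φ x := fun x ↦ by
        rw [hwdef, hφdef]; have := hρge x; dsimp only; linarith
      -- smoothness
      have hF : ContMDiff (𝓡 m) 𝓘(ℝ, ℝ) ∞ (fun x ↦ v x ^ 2 + δ ^ 2) :=
        (hv.pow 2).add contMDiff_const
      have hρs : ContMDiff (𝓡 m) 𝓘(ℝ, ℝ) ∞ ρ := by
        rw [hρdef]
        intro x
        exact ((Real.contDiffAt_sqrt (hin x).ne').contMDiffAt).comp x (hF x)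
      have hφs : ContMDiff (𝓡 m) 𝓘(ℝ, ℝ) ∞ φ := by
        rw [hφdef]; exact (hρs.sub hv).div_const _
      have hφ1 : ContMDiff (𝓡 m) 𝓘(ℝ, ℝ) 1 φ := hφs.of_le (WithTop.coe_le_coe.mpr le_top)
      have hρ1 : ContMDiff (𝓡 m) 𝓘(ℝ, ℝ) 1 ρ := hρs.of_le (WithTop.coe_le_coe.mpr le_top)
      have hφc : Continuous φ := hφs.continuous
      -- the differential of `φ`: `dφ = −(φ/ρ) dv`
      have hdρ : ∀ x w₀, mvfderiv (𝓡 m) ρ x w₀ = (v x / ρ x) * mvfderiv (𝓡 m) v x w₀ := by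
        intro x w₀
        have hvd : MDifferentiableAt (𝓡 m) 𝓘(ℝ, ℝ) v x := (hv1 x).mdifferentiableAt one_ne_zero
        have hFd : MDifferentiableAt (𝓡 m) 𝓘(ℝ, ℝ) (fun y ↦ v y ^ 2 + δ ^ 2) x :=
          ((hF.of_le (WithTop.coe_le_coe.mpr le_top) : ContMDiff (𝓡 m) 𝓘(ℝ, ℝ) 1 _) x)
            |>.mdifferentiableAt one_ne_zero
        have h1 : ρ = Real.sqrt ∘ fun y ↦ v y ^ 2 + δ ^ 2 := by rw [hρdef]; rfl
        have h2 : (fun y ↦ v y ^ 2 + δ ^ 2) = (fun t : ℝ ↦ t ^ 2 + δ ^ 2) ∘ v := rfl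
        have hsq : HasDerivAt (fun t : ℝ ↦ t ^ 2 + δ ^ 2) (2 * v x) (v x) := by
          simpa using ((hasDerivAt_pow 2 (v x)).add_const (δ ^ 2))
        rw [h1, mvfderiv_real_comp (u := fun y ↦ v y ^ 2 + δ ^ 2) (ζ := Real.sqrt)
          (Real.hasDerivAt_sqrt (hin x).ne').differentiableAt hFd,
          (Real.hasDerivAt_sqrt (hin x).ne').deriv, h2,
          mvfderiv_real_comp (u := v) (ζ := fun t : ℝ ↦ t ^ 2 + δ ^ 2) hsq.differentiableAt hvd,
          hsq.deriv]
        simp only [Function.comp_apply]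
        have := (Real.sqrt_pos.2 (hin x)).ne'
        field_simp
      have hdφ : ∀ x w₀, mvfderiv (𝓡 m) φ x w₀ = -(φ x / ρ x) * mvfderiv (𝓡 m) v x w₀ := by
        intro x w₀
        have hvd : MDifferentiableAt (𝓡 m) 𝓘(ℝ, ℝ) v x := (hv1 x).mdifferentiableAt one_ne_zero
        have hρd : MDifferentiableAt (𝓡 m) 𝓘(ℝ, ℝ) ρ x := (hρ1 x).mdifferentiableAt one_ne_zero
        have h1 : φ = (fun t : ℝ ↦ t / 2) ∘ (ρ - v) := by rw [hφdef]; rfl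
        have hlin : HasDerivAt (fun t : ℝ ↦ t / 2) (1 / 2) ((ρ - v) x) := by
          simpa using (hasDerivAt_id ((ρ - v) x)).div_const 2
        rw [h1, mvfderiv_real_comp (u := ρ - v) (ζ := fun t : ℝ ↦ t / 2) hlin.differentiableAt
          (hρd.sub hvd), hlin.deriv, mvfderiv_sub hρd hvd, _root_.sub_apply, hdρ]
        simp only [Function.comp_apply, Pi.sub_apply]
        have := (hρpos x).ne'
        field_simp
        ring
      -- pointwise: `h⁻¹(dφ, dφ) + h⁻¹(dv, dφ) ≤ 0`
      have hpt : ∀ x, (ofRiemannian h).innerDual x (mvfderiv (𝓡 m) φ x).toLinearMap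
            (mvfderiv (𝓡 m) φ x).toLinearMap +
          (ofRiemannian h).innerDual x (mvfderiv (𝓡 m) v x).toLinearMap
            (mvfderiv (𝓡 m) φ x).toLinearMap ≤ 0 := by
        intro x
        have hcl : mvfderiv (𝓡 m) φ x = (-(φ x / ρ x)) • mvfderiv (𝓡 m) v x := by
          ext w₀; rw [hdφ]; rfl
        set t : ℝ := φ x / ρ x with ht
        have ht0 : 0 ≤ t := div_nonneg (hφ0 x) (hρpos x).le
        have ht1 : t ≤ 1 := (div_le_one (hρpos x)).2 (hφle x)
        have hG := innerDual_self_nonneg h x (mvfderiv (𝓡 m) v x).toLinearMap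
        rw [hcl]
        simp only [ContinuousLinearMap.toLinearMap_smul, PseudoRiemannianMetric.innerDual,
          LinearMap.smul_apply, smul_eq_mul, map_smul]
        simp only [PseudoRiemannianMetric.innerDual] at hG
        nlinarith [mul_nonneg ht0 hG, mul_nonneg (sub_nonneg.2 ht1) hG,
          mul_nonneg (mul_nonneg ht0 (sub_nonneg.2 ht1)) hG]
      -- Green's identity and the equation: `−∫ h⁻¹(dφ, dv) = ∫ φ Δv = ∫ φ (g + f v)`
      have hGreen := integral_mul_dalembertian_eq_neg_integral_innerDual h hφ1 hv2
      have hΔeq : ∫ x, φ x * (ofRiemannian h).dalembertian v x ∂μ =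
          ∫ x, (φ x * g x + f x * v x * φ x) ∂μ :=
        integral_congr_ae (Eventually.of_forall fun x ↦ by
          show φ x * (ofRiemannian h).dalembertian v x = φ x * g x + f x * v x * φ x
          rw [← hpde x]; ring)
      -- integrability facts
      have hiφφ : Integrable (fun x ↦ (ofRiemannian h).innerDual x (mvfderiv (𝓡 m) φ x).toLinearMap
          (mvfderiv (𝓡 m) φ x).toLinearMap) μ := hint (continuous_innerDual_mvfderiv _ hφ1 hφ1)
      have hivφ : Integrable (fun x ↦ (ofRiemannian h).innerDual x (mvfderiv (𝓡 m) v x).toLinearMap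
          (mvfderiv (𝓡 m) φ x).toLinearMap) μ := hint (continuous_innerDual_mvfderiv _ hv1 hφ1)
      have hiφv : Integrable (fun x ↦ (ofRiemannian h).innerDual x (mvfderiv (𝓡 m) φ x).toLinearMap
          (mvfderiv (𝓡 m) v x).toLinearMap) μ := hint (continuous_innerDual_mvfderiv _ hφ1 hv1)
      have hifφ2 : Integrable (fun x ↦ f x * φ x ^ 2) μ := hint (hf.mul (hφc.pow 2))
      have hiφg : Integrable (fun x ↦ φ x * g x) μ := hint (hφc.mul hgc)
      have hifvφ : Integrable (fun x ↦ f x * v x * φ x) μ := hint ((hf.mul hvc).mul hφc)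
      have hsymm : ∫ x, (ofRiemannian h).innerDual x (mvfderiv (𝓡 m) φ x).toLinearMap
            (mvfderiv (𝓡 m) v x).toLinearMap ∂μ =
          ∫ x, (ofRiemannian h).innerDual x (mvfderiv (𝓡 m) v x).toLinearMap
            (mvfderiv (𝓡 m) φ x).toLinearMap ∂μ :=
        integral_congr_ae (Eventually.of_forall fun x ↦
          PseudoRiemannianMetric.innerDual_comm (ofRiemannian h) x _ _)
      -- coercivity at `φ`
      have hco := hcoer φ hφs
      rw [integral_add hiφφ hifφ2] at hco
      -- `∫ |dφ|² ≤ −∫ h⁻¹(dv, dφ)`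
      have hle1 : ∫ x, (ofRiemannian h).innerDual x (mvfderiv (𝓡 m) φ x).toLinearMap
            (mvfderiv (𝓡 m) φ x).toLinearMap ∂μ ≤
          -∫ x, (ofRiemannian h).innerDual x (mvfderiv (𝓡 m) v x).toLinearMap
            (mvfderiv (𝓡 m) φ x).toLinearMap ∂μ := by
        have := integral_nonpos (μ := μ) fun x ↦ hpt x
        rw [integral_add hiφφ hivφ] at this
        linarith
      -- `−∫ h⁻¹(dv, dφ) = ∫ φ g + ∫ f v φ ≤ ∫ f v φ`
      have hle2 : -∫ x, (ofRiemannian h).innerDual x (mvfderiv (𝓡 m) v x).toLinearMap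
            (mvfderiv (𝓡 m) φ x).toLinearMap ∂μ ≤ ∫ x, f x * v x * φ x ∂μ := by
        rw [← hsymm, ← hGreen, hΔeq, integral_add hiφg hifvφ]
        have : ∫ x, φ x * g x ∂μ ≤ 0 :=
          integral_nonpos fun x ↦ mul_nonpos_of_nonneg_of_nonpos (hφ0 x) (hg x).le
        linarith
      -- `∫ f v φ + ∫ f φ² = (δ²/4) ∫ f`
      have hsum : ∫ x, f x * v x * φ x ∂μ + ∫ x, f x * φ x ^ 2 ∂μ = δ ^ 2 / 4 * ∫ x, f x ∂μ := by
        rw [← integral_add hifvφ hifφ2, ← integral_const_mul]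
        refine integral_congr_ae (Eventually.of_forall fun x ↦ ?_)
        have hρ2 : ρ x ^ 2 = v x ^ 2 + δ ^ 2 := by
          rw [hρdef]; exact Real.sq_sqrt (hin x).le
        have hφx : φ x = (ρ x - v x) / 2 := by rw [hφdef]
        show f x * v x * φ x + f x * φ x ^ 2 = δ ^ 2 / 4 * f x
        rw [hφx]
        linear_combination (f x / 4) * hρ2
      -- `∫ w² ≤ ∫ φ²` and `∫ f ≤ ∫ |f|`
      have hwle : ∫ x, w x ^ 2 ∂μ ≤ ∫ x, φ x ^ 2 ∂μ :=
        integral_mono (hint (hwc.pow 2)) (hint (hφc.pow 2)) fun x ↦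
          pow_le_pow_left₀ (hw0 x) (hwφ x) 2
      have hfle : ∫ x, f x ∂μ ≤ ∫ x, |f x| ∂μ :=
        integral_mono (hint hf) (hint hf.abs) fun x ↦ le_abs_self _
      have hδ4 : 0 ≤ δ ^ 2 / 4 := by positivity
      nlinarith [mul_le_mul_of_nonneg_left hwle hc.le, mul_le_mul_of_nonneg_left hfle hδ4]
    -- hence `∫ w² = 0`, `w = 0`
    have hIw : ∫ x, w x ^ 2 ∂μ ≤ 0 := by
      refine le_of_not_gt fun hcon ↦ ?_
      set A : ℝ := ∫ x, |f x| ∂μ with hA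
      have hA0 : 0 ≤ A := integral_nonneg fun x ↦ abs_nonneg _
      -- choose `δ` with `δ² (A + 1) < 4 c ∫ w²`
      obtain ⟨δ, hδ, hδ2⟩ : ∃ δ : ℝ, 0 < δ ∧ δ ^ 2 < 4 * c * (∫ x, w x ^ 2 ∂μ) / (A + 1) := by
        have hpos : 0 < 4 * c * (∫ x, w x ^ 2 ∂μ) / (A + 1) := by positivity
        refine ⟨min 1 (4 * c * (∫ x, w x ^ 2 ∂μ) / (A + 1) / 2), by positivity, ?_⟩
        have hm1 : min 1 (4 * c * (∫ x, w x ^ 2 ∂μ) / (A + 1) / 2) ≤ 1 := min_le_left _ _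
        have hm2 : min 1 (4 * c * (∫ x, w x ^ 2 ∂μ) / (A + 1) / 2) ≤
            4 * c * (∫ x, w x ^ 2 ∂μ) / (A + 1) / 2 := min_le_right _ _
        have hm0 : 0 < min 1 (4 * c * (∫ x, w x ^ 2 ∂μ) / (A + 1) / 2) := by positivity
        nlinarith
      have hk := hkey δ hδ
      rw [lt_div_iff₀ (by positivity)] at hδ2
      nlinarith
    have hI0 : ∫ x, w x ^ 2 ∂μ = 0 :=
      le_antisymm hIw (integral_nonneg fun x ↦ sq_nonneg _)
    have hae := (integral_eq_zero_iff_of_nonneg (fun x ↦ sq_nonneg _) (hint (hwc.pow 2))).1 hI0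
    have hfun : (fun x ↦ w x ^ 2) = fun _ ↦ (0 : ℝ) :=
      (Continuous.ae_eq_iff_eq μ (hwc.pow 2) continuous_const).1 hae
    intro x
    have hx : w x ^ 2 = 0 := congr_fun hfun x
    have hwx : w x = 0 := (pow_eq_zero_iff two_ne_zero).1 hx
    rw [hwdef] at hwx
    have := abs_nonneg (v x)
    have h' : |v x| = v x := by dsimp only at hwx; linarith
    rw [← h']
    exact abs_nonneg _
  /- Step 2: strict positivity at every point -/
  by_contra hnot
  have hp0 : v p = 0 := le_antisymm (not_lt.1 hnot) (hnonneg p)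
  have hmax : IsMaxOn (-v) univ p := fun x _ ↦ by
    show -v x ≤ -v p
    rw [hp0, neg_zero, neg_nonpos]
    exact hnonneg x
  have hΔ := Literature.Geometry.Riemannian.laplaceBeltrami_nonpos_of_isMaxOn (ofRiemannian h)
    (fun w hw ↦ isRiemannian_ofRiemannian h p w hw) (hv2.neg) hmax
  change (ofRiemannian h).laplaceBeltrami (-v) p ≤ 0 at hΔ
  rw [laplaceBeltrami_neg, laplaceBeltrami_eq_dalembertian] at hΔ
  have hpde' := hpde p
  rw [hp0, mul_zero, sub_zero] at hpde'
  linarith [hg p]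

/-- **Smooth positive solutions.** Under the coercivity hypothesis of
`exists_smooth_solution_of_coercive`, for smooth `f` and smooth `g < 0` there is a smooth
everywhere positive `v` with `Δ_h v − f v = g`. With `f = σ/6`, `g = −1/6` this is the positive
solution `u` of `−6Δ_g u + σ u = 1` used to produce a conformal metric `u² g` of positive
modified scalar curvature `σ_{u²g} = u⁻³(−6Δu + σu)` (Gursky–LeBrun 1998, Prop. 3; Chen–Zhu 2014,
Cor. 2.2). [cite: GurskyLebrun1998, Prop. 3] [cite: ChenZhu2014, Cor. 2.2] -/
theorem exists_smooth_pos_solution_of_coercive [Nontrivial (EuclideanSpace ℝ (Fin m))]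
    {f g : N → ℝ} (hf : ContMDiff (𝓡 m) 𝓘(ℝ, ℝ) ∞ f) (hg : ContMDiff (𝓡 m) 𝓘(ℝ, ℝ) ∞ g)
    (hgneg : ∀ p, g p < 0) {c : ℝ} (hc : 0 < c)
    (hcoer : ∀ φ : N → ℝ, ContMDiff (𝓡 m) 𝓘(ℝ, ℝ) ∞ φ →
      c * ∫ x, φ x ^ 2 ∂riemannianMeasure h ≤
        ∫ x, ((ofRiemannian h).innerDual x (mvfderiv (𝓡 m) φ x).toLinearMap
          (mvfderiv (𝓡 m) φ x).toLinearMap + f x * φ x ^ 2) ∂riemannianMeasure h) :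
    ∃ v : N → ℝ, ContMDiff (𝓡 m) 𝓘(ℝ, ℝ) ∞ v ∧ (∀ p, 0 < v p) ∧
      ∀ p, (ofRiemannian h).dalembertian v p - f p * v p = g p := by
  obtain ⟨v, hv, hpde⟩ := exists_smooth_solution_of_coercive h hf hg hc hcoer
  exact ⟨v, hv, pos_of_dalembertian_sub_mul_eq_of_coercive h hf.continuous hc hcoer hv hpde hgneg,
    hpde⟩

end Smooth

end Literature.Geometry.Lorentzian

end
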